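import Literature.NumberTheory.Automorphic.Liu2021.LemD1AsPrintedIndexedNonVacuityDetLineCarriers
import Literature.NumberTheory.Automorphic.Liu2021.LemD1AsPrintedIndexedNonVacuityInertEpsAlone
import HarnessLib

/-!
# [Liu2021, App. D Lemma D.1 (3)] bookkeeping — THE DET-LINE DECISION at EVERY finite place for EVERY rank `N ≥ 2`:
# a det-line carrier with trivial central character exists at `w ∣ v` ⟺ `E_v¹` is not `N`-divisible ⟺
# NOT (`w` non-split ∧ `N` odd ∧ `v_w(N) = 1` ∧ (`e(w|v) ≠ 1` ∨ `gcd(N, q_v + 1) = 1`))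

Reproduction ∕ bookkeeping (Literature, THEOREMS ONLY: no definition, no record, no named fact, no `sorry`; nothing is
asserted about Liu's oscillator representations or about the tree's constructed local Weil carriers).

Sequel of ✔ `…DetLineCarriers` (the carriers with `Ψ g = θ(det g)` in the type, every source) and of the converses ✔ `…InertConverse`,
✔ `…RamifiedConverse`, ✔ `…TameSynthesis`.  For ANY quadratic extension `E/F` of number fields with `c ≠ 1`, ANY hermitian non-degenerate
`J` of ANY rank `N ≥ 2`, ANY finite place `v` of `F` and ANY `w ∣ v`, in the place model `S = LemD1OfPlace.standingData` of [Liu2021, App. D §D.1]: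

* §1 **`exists_detLine_carrier_iff`** — «there are `Ψ : U(V)(F_v) → ℂˣ` and `θ : E_v¹ → ℂˣ` with `Ψ g = θ(det g)`, `Ψ ∘ S.scalar = 1`,
  `Ψ ≠ 1`» ⟺ **¬ (`c • w = w` ∧ `Odd N` ∧ `v_w(N) = 1` ∧ (`e(w|v) ≠ 1` ∨ `Nat.Coprime N (q_v + 1)`))**; the «⟸» half with the full printed
  strength (open kernel, `Ψ^N = 1`, `|Ψ| = 1`): **`exists_detLine_carrier_of_not`**; the «⟹» half = ✔ `…TameSynthesis.eq_one_of_factors_through_det_of_nonsplit`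
  (**`forall_eq_one_of_factors_through_det`**).  The four escape routes are the lineage's four carriers: split (✔ `…DetCarrier`), `N` even
  (`ζ = −1`), wild `v_w(N) < 1` (✔ `…WildCarrier`), inert with `gcd(N, q_v + 1) > 1` (✔ `…InertCarrier`).
* §2 **`forall_exists_pow_eq_iff`** — `E_v¹ = (E_v¹)^N` ⟺ the SAME conjunction (✔ `…InertConverse.exists_pow_eq_of_mem_normOne`,
  ✔ `…RamifiedConverse.exists_pow_eq_of_mem_normOne_of_ramified`; ✔ `…DetLineCarriers.not_forall_exists_pow_eq_of_detLine_carrier`), and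
  **`exists_detLine_carrier_iff_not_forall_exists_pow_eq`** — carrier ⟺ `E_v¹ ≠ (E_v¹)^N`.
* §3 `N` EVEN `≥ 4`, EVERY non-split place: the JOINT certificates «(1) ∧ (3)» with the `μ`-conjunct ALONE resp. the `ε`-conjunct ALONE
  separating (✔ `…InertCarrier.…_mu_of_norm_one`, ✔ `…InertEpsAlone.…_eps_of_norm_one` at `ζ = −1`) and their hypothesis-free `not_forall_…` forms.
* §4 the CM rows (`L` CM, `F = L⁺`): the decision, the even-`N` certificates with the rows' OWN `μ_v = localMu L (toHeckeCharacter L ψ) v` as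
  member `0`, and THE END's `N = 3` as ONE iff: a det-line carrier exists at `w ∣ v` ⟺ ¬ (`\bar w = w` ∧ `v_w(3) = 1` ∧ (`e(w|v) ≠ 1` ∨ `3 ∤ q_v + 1`)).

What this does NOT give: non-line carriers (characters of `U(V)(F_v)` not factoring through `det` — the simple group `SU(V)(F_v)`);
the rows' OWN carriers `𝓢.omegaLoc v`; Lem. D.1 itself.  HC_CM is NOT proved.

Cell pub-hodgecm2 (COR-CM), audit class of the END rows `hD1''` ∕ `hD3`; seat prover-pub-hodgecm2-b10.

References: [Liu2021] Y. Liu, *Fourier–Jacobi cycles and arithmetic relative trace formula*, Camb. J. Math. 9 (2021) =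
arXiv:2102.11518, App. D §D.1 (l. 5213–5221), Lemma D.1 (1) (l. 5229), (3) (l. 5233); [NeukirchANT1999] J. Neukirch, *Algebraic Number
Theory* (1999), Ch. I §8 Prop. (8.2), Ch. I §9 Exercise 2, Ch. II §3 Prop. (3.10), Ch. II §4 Lemma (4.6), Ch. II §5 Prop. (5.3);
[Mok2014] C. P. Mok, Mem. AMS 235 (2015), §1 Notation p. 5; [CasselsFrohlichANT1967] Ch. II §10.
-/

noncomputable section

open scoped Matrix MatrixGroups
open NumberField IsDedekindDomain
open Literature.RepresentationTheory
open Literature.RepresentationTheory.Liu2021 (OscillatorStandingData)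
open Literature.NumberTheory.GaloisRepresentations (HeckeCharacter)

namespace Literature.NumberTheory.Automorphic.Liu2021.LemD1IndexedNonVacuityDetLineDecision

open UnitaryGroup

/-! ## §1 THE DECISION: det-line carrier at `w` ⟺ ¬ (non-split ∧ `N` odd ∧ tame ∧ (ramified ∨ `gcd(N, q_v + 1) = 1`)) -/

section PlaceModel

variable {F : Type} (E : Type) [Field F] [NumberField F] [Field E] [NumberField E] [Algebra F E]
  [Algebra.IsQuadraticExtension F E] (v : HeightOneSpectrum (𝓞 F)) (c : E ≃ₐ[F] E)
  {δ : E} (hcδ : c δ = -δ) (hδ : δ ≠ 0)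
  (N : ℕ) (J : Matrix (Fin N) (Fin N) E) (hN : 2 ≤ N) (hJh : (J.map c)ᵀ = J) (hJdet : J.det ≠ 0)

omit [NumberField F] [Algebra.IsQuadraticExtension F E] in
include hcδ hδ in
/-- `c ≠ 1` (`c δ = −δ ≠ δ`); copy of the siblings' private lemma. [folklore] -/
private theorem hc_of_delta : c ≠ 1 := by
  rintro rfl
  rw [AlgEquiv.one_apply] at hcδ
  have h2 : (2 : E) * δ = 0 := by linear_combination hcδ
  exact hδ ((mul_eq_zero.mp h2).resolve_left two_ne_zero)

omit [Algebra F E] [Algebra.IsQuadraticExtension F E] in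
/-- `v_w(k) ≤ 1` for a natural number `k` (copy of the private lemma of ✔ `…WildCarrier`). [folklore] -/
private theorem valued_natCast_le_one (w : HeightOneSpectrum (𝓞 E)) (k : ℕ) : Valued.v ((k : w.adicCompletion E)) ≤ 1 := by
  induction k with
  | zero => simp
  | succ k ih =>
    rw [Nat.cast_succ]
    exact Valuation.map_add_le _ ih (by rw [Valuation.map_one])

/-- determinants of `U(V)(F_v)` are norm-one; copy of the siblings' private lemma. [cite: Liu2021, App. D §D.1 (l. 5213)] [cite: Mok2014, §1 Notation p. 5] -/
private theorem det_mem_normOne (g : (LemD1OfPlace.standingData E v c N J hcδ hδ hN hJh hJdet).U) :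
    Matrix.GeneralLinearGroup.det (g : GL (Fin N) (LocalRing E v)) ∈ (LemD1OfPlace.standingData E v c N J hcδ hδ hN hJh hJdet).normOne := by
  let S := LemD1OfPlace.standingData E v c N J hcδ hδ hN hJh hJdet
  rw [OscillatorStandingData.mem_normOne_iff', Matrix.GeneralLinearGroup.val_det_apply]
  have hg := (OscillatorStandingData.mem_U_iff S _).1 g.2
  have h := congrArg Matrix.det hg
  rw [Matrix.det_mul, Matrix.det_mul, Matrix.det_transpose] at h
  have hc : (((g : GL (Fin N) (LocalRing E v)) : Matrix (Fin N) (Fin N) (LocalRing E v)).map S.conj).det =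
      S.conj (((g : GL (Fin N) (LocalRing E v)) : Matrix (Fin N) (Fin N) (LocalRing E v)).det) := by
    rw [AlgEquiv.map_det, AlgEquiv.mapMatrix_apply]
  rw [hc] at h
  have h2 : (((g : GL (Fin N) (LocalRing E v)) : Matrix (Fin N) (Fin N) (LocalRing E v)).det *
      S.conj (((g : GL (Fin N) (LocalRing E v)) : Matrix (Fin N) (Fin N) (LocalRing E v)).det) - 1) * S.gram.det = 0 := by
    linear_combination h
  exact sub_eq_zero.1 ((S.isUnit_det_gram.mul_left_eq_zero).1 h2)

/-- `det (z · 1_N) = z^N` in `(E_v)ˣ`. [cite: Liu2021, App. D §D.1 Step 3 (l. 5221)] -/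
private theorem det_scalar_val (z : (LemD1OfPlace.standingData E v c N J hcδ hδ hN hJh hJdet).normOne) :
    Matrix.GeneralLinearGroup.det (((LemD1OfPlace.standingData E v c N J hcδ hδ hN hJh hJdet).scalar z :
        (LemD1OfPlace.standingData E v c N J hcδ hδ hN hJh hJdet).U) : GL (Fin N) (LocalRing E v)) =
      (z : (LocalRing E v)ˣ) ^ N := by
  apply Units.ext
  rw [Matrix.GeneralLinearGroup.val_det_apply, OscillatorStandingData.coe_scalar, Matrix.scalar_apply, Matrix.det_diagonal,
    Finset.prod_const, Finset.card_univ, Fintype.card_fin, Units.val_pow_eq_pow_val]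

include hcδ in
/-- **«⟹»: under the conjunction NO det-line carrier** — `c • w = w`, `N` odd, `v_w(N) = 1` and (`e(w|v) ≠ 1` ∨ `gcd(N, q_v + 1) = 1`) force
every det-factoring centre-trivial character of `U(V)(F_v)` to be trivial (✔ `…TameSynthesis.eq_one_of_factors_through_det_of_nonsplit`,
hypotheses bundled). [cite: Liu2021, App. D §D.1 Step 3 (l. 5221) and Lemma D.1 (3) (l. 5233)] [cite: NeukirchANT1999, Ch. II §4 Lemma (4.6)] -/
theorem forall_eq_one_of_factors_through_det (w : PlacesOver E v)
    (h : c • w.1 = w.1 ∧ Odd N ∧ Valued.v ((N : w.1.adicCompletion E)) = 1 ∧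
      (v.asIdeal.ramificationIdx' w.1.asIdeal ≠ 1 ∨ Nat.Coprime N (Nat.card (𝓞 F ⧸ v.asIdeal) + 1)))
    (Ψ : (LemD1OfPlace.standingData E v c N J hcδ hδ hN hJh hJdet).U →* ℂˣ)
    (θ : (LemD1OfPlace.standingData E v c N J hcδ hδ hN hJh hJdet).normOne →* ℂˣ)
    (hΨ : ∀ (g : (LemD1OfPlace.standingData E v c N J hcδ hδ hN hJh hJdet).U)
      (hg : Matrix.GeneralLinearGroup.det (g : GL (Fin N) (LocalRing E v)) ∈
        (LemD1OfPlace.standingData E v c N J hcδ hδ hN hJh hJdet).normOne),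
      Ψ g = θ ⟨Matrix.GeneralLinearGroup.det (g : GL (Fin N) (LocalRing E v)), hg⟩)
    (hcen : ∀ z : (LemD1OfPlace.standingData E v c N J hcδ hδ hN hJh hJdet).normOne,
      Ψ ((LemD1OfPlace.standingData E v c N J hcδ hδ hN hJh hJdet).scalar z) = 1) :
    Ψ = 1 :=
  LemD1IndexedNonVacuityTameSynthesis.eq_one_of_factors_through_det_of_nonsplit E v c hcδ hδ N J hN hJh hJdet w h.1 h.2.1 h.2.2.1
    h.2.2.2 Ψ θ hΨ hcen

include hcδ in
/-- **«⟸»: outside the conjunction a det-line carrier EXISTS, at full printed strength** (`Ψ g = θ(det g)` in the type, `Ψ ∘ S.scalar = 1`,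
open kernel, `Ψ ≠ 1`, `Ψ^N = 1`, `|Ψ| = 1`) — by the four carriers of ✔ `…DetLineCarriers`: split (`c • w ≠ w`), `N` even (`ζ = −1`), wild
(`v_w(N) < 1`), inert with `gcd(N, q_v + 1) > 1` (`e(w|v) = 1`). [cite: Liu2021, App. D §D.1 Step 3 (l. 5221)]
[cite: NeukirchANT1999, Ch. II §3 Prop. (3.10) and Ch. I §9 Exercise 2] -/
theorem exists_detLine_carrier_of_not (w : PlacesOver E v)
    (h : ¬ (c • w.1 = w.1 ∧ Odd N ∧ Valued.v ((N : w.1.adicCompletion E)) = 1 ∧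
      (v.asIdeal.ramificationIdx' w.1.asIdeal ≠ 1 ∨ Nat.Coprime N (Nat.card (𝓞 F ⧸ v.asIdeal) + 1)))) :
    ∃ (Ψ : (LemD1OfPlace.standingData E v c N J hcδ hδ hN hJh hJdet).U →* ℂˣ)
      (θ : (LemD1OfPlace.standingData E v c N J hcδ hδ hN hJh hJdet).normOne →* ℂˣ),
      (∀ (g : (LemD1OfPlace.standingData E v c N J hcδ hδ hN hJh hJdet).U)
        (hg : Matrix.GeneralLinearGroup.det (g : GL (Fin N) (LocalRing E v)) ∈
          (LemD1OfPlace.standingData E v c N J hcδ hδ hN hJh hJdet).normOne),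
        Ψ g = θ ⟨Matrix.GeneralLinearGroup.det (g : GL (Fin N) (LocalRing E v)), hg⟩) ∧
      (∀ z : (LemD1OfPlace.standingData E v c N J hcδ hδ hN hJh hJdet).normOne,
        Ψ ((LemD1OfPlace.standingData E v c N J hcδ hδ hN hJh hJdet).scalar z) = 1) ∧
      (∃ O : Set (LemD1OfPlace.standingData E v c N J hcδ hδ hN hJh hJdet).U, IsOpen O ∧ 1 ∈ O ∧ ∀ g ∈ O, Ψ g = 1) ∧
      (∃ g₀ : (LemD1OfPlace.standingData E v c N J hcδ hδ hN hJh hJdet).U, Ψ g₀ ≠ 1) ∧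
      (∀ g, Ψ g ^ N = 1) ∧ (∀ g, ‖((Ψ g : ℂˣ) : ℂ)‖ = 1) := by
  by_cases hw : c • w.1 = w.1
  · by_cases hNe : Even N
    · exact LemD1IndexedNonVacuityDetLineCarriers.exists_detLine_carrier_of_even E v c hcδ hδ N J hN hJh hJdet w hw hNe
    · have hNodd : Odd N := Nat.not_even_iff_odd.1 hNe
      by_cases hNv : Valued.v ((N : w.1.adicCompletion E)) = 1
      · have h' : ¬ (v.asIdeal.ramificationIdx' w.1.asIdeal ≠ 1 ∨ Nat.Coprime N (Nat.card (𝓞 F ⧸ v.asIdeal) + 1)) :=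
          fun h'' => h ⟨hw, hNodd, hNv, h''⟩
        rw [not_or, not_not] at h'
        exact LemD1IndexedNonVacuityDetLineCarriers.exists_detLine_carrier_of_inert E v c hcδ hδ N J hN hJh hJdet w hw h'.1 h'.2
      · exact LemD1IndexedNonVacuityDetLineCarriers.exists_detLine_carrier_of_wild E v c hcδ hδ N J hN hJh hJdet w hw
          (lt_of_le_of_ne (valued_natCast_le_one E w.1 N) hNv)
  · exact LemD1IndexedNonVacuityDetLineCarriers.exists_detLine_carrier_of_split E v c hcδ hδ N J hN hJh hJdet w hw

include hcδ in
/-- **THE DET-LINE DECISION** (ANY quadratic `E/F`, ANY hermitian `J` of ANY rank `N ≥ 2`, ANY finite place `w ∣ v`): a character `Ψ = θ ∘ det`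
of `U(V)(F_v)` trivial on the centre `S.scalar(E_v¹)` and non-trivial EXISTS if and only if it is NOT the case that `w` is non-split, `N` is
odd, `v_w(N) = 1`, and `w` is ramified over `v` or `gcd(N, q_v + 1) = 1`. [cite: Liu2021, App. D §D.1 Step 3 (l. 5221) and Lemma D.1 (3) (l. 5233)]
[cite: NeukirchANT1999, Ch. II §4 Lemma (4.6) and §5 Prop. (5.3)] -/
theorem exists_detLine_carrier_iff (w : PlacesOver E v) :
    (∃ (Ψ : (LemD1OfPlace.standingData E v c N J hcδ hδ hN hJh hJdet).U →* ℂˣ)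
        (θ : (LemD1OfPlace.standingData E v c N J hcδ hδ hN hJh hJdet).normOne →* ℂˣ),
        (∀ (g : (LemD1OfPlace.standingData E v c N J hcδ hδ hN hJh hJdet).U)
          (hg : Matrix.GeneralLinearGroup.det (g : GL (Fin N) (LocalRing E v)) ∈
            (LemD1OfPlace.standingData E v c N J hcδ hδ hN hJh hJdet).normOne),
          Ψ g = θ ⟨Matrix.GeneralLinearGroup.det (g : GL (Fin N) (LocalRing E v)), hg⟩) ∧
        (∀ z : (LemD1OfPlace.standingData E v c N J hcδ hδ hN hJh hJdet).normOne,
          Ψ ((LemD1OfPlace.standingData E v c N J hcδ hδ hN hJh hJdet).scalar z) = 1) ∧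
        Ψ ≠ 1) ↔
      ¬ (c • w.1 = w.1 ∧ Odd N ∧ Valued.v ((N : w.1.adicCompletion E)) = 1 ∧
        (v.asIdeal.ramificationIdx' w.1.asIdeal ≠ 1 ∨ Nat.Coprime N (Nat.card (𝓞 F ⧸ v.asIdeal) + 1))) := by
  constructor
  · rintro ⟨Ψ, θ, hfac, hcen, hne⟩ h
    exact hne (forall_eq_one_of_factors_through_det E v c hcδ hδ N J hN hJh hJdet w h Ψ θ hfac hcen)
  · intro h
    obtain ⟨Ψ, θ, hfac, hcen, -, ⟨g₀, hg₀⟩, -, -⟩ := exists_detLine_carrier_of_not E v c hcδ hδ N J hN hJh hJdet w h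
    exact ⟨Ψ, θ, hfac, hcen, fun h1 => hg₀ (by rw [h1, MonoidHom.one_apply])⟩

/-! ## §2 `E_v¹ = (E_v¹)^N` ⟺ the same conjunction; carrier ⟺ `E_v¹ ≠ (E_v¹)^N` -/

include hcδ in
/-- **`N`-DIVISIBILITY OF `E_v¹` DECIDED**: every element of `S.normOne = E_v¹` is an `N`-th power of an element of `E_v¹` if and only if
`c • w = w`, `N` is odd, `v_w(N) = 1`, and (`e(w|v) ≠ 1` ∨ `gcd(N, q_v + 1) = 1`) — «⟸» by ✔ `…RamifiedConverse.exists_pow_eq_of_mem_normOne_of_ramified`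
∕ ✔ `…InertConverse.exists_pow_eq_of_mem_normOne` (Hensel; `c_w = id` resp. `Frob` on the residue field), «⟹» because each of the four
carriers of ✔ `…DetLineCarriers` kills `(E_v¹)^N` without being trivial. [cite: NeukirchANT1999, Ch. II §4 Lemma (4.6) and §5 Prop. (5.3); Ch. I §9 Exercise 2]
[cite: Liu2021, App. D §D.1 Step 3 (l. 5221)] -/
theorem forall_exists_pow_eq_iff (w : PlacesOver E v) :
    (∀ z : (LemD1OfPlace.standingData E v c N J hcδ hδ hN hJh hJdet).normOne,
        ∃ y : (LemD1OfPlace.standingData E v c N J hcδ hδ hN hJh hJdet).normOne, y ^ N = z) ↔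
      (c • w.1 = w.1 ∧ Odd N ∧ Valued.v ((N : w.1.adicCompletion E)) = 1 ∧
        (v.asIdeal.ramificationIdx' w.1.asIdeal ≠ 1 ∨ Nat.Coprime N (Nat.card (𝓞 F ⧸ v.asIdeal) + 1))) := by
  constructor
  · intro hdiv
    by_contra h
    obtain ⟨Ψ, θ, hfac, hcen, -, hne, -, -⟩ := exists_detLine_carrier_of_not E v c hcδ hδ N J hN hJh hJdet w h
    exact LemD1IndexedNonVacuityDetLineCarriers.not_forall_exists_pow_eq_of_detLine_carrier E v c hcδ hδ N J hN hJh hJdet Ψ θ hfac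
      hcen hne hdiv
  · rintro ⟨hw, hNodd, hNv, h⟩ z
    by_cases he : v.asIdeal.ramificationIdx' w.1.asIdeal = 1
    · exact LemD1IndexedNonVacuityInertConverse.exists_pow_eq_of_mem_normOne E v c hcδ hδ N J hN hJh hJdet
        (LemD1IndexedNonVacuityTameSynthesis.isUnramifiedIn_of_ramificationIdx'_eq_one E c v (hc_of_delta E c hcδ hδ) w hw he) w hw
        hNv (h.resolve_left fun hne => hne he) z
    · exact LemD1IndexedNonVacuityRamifiedConverse.exists_pow_eq_of_mem_normOne_of_ramified E v c hcδ hδ N J hN hJh hJdet w hw he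
        hNodd hNv z

include hcδ in
/-- **det-line carrier ⟺ `E_v¹ ≠ (E_v¹)^N`** (every place, every `N ≥ 2`). [cite: NeukirchANT1999, Ch. II §5 Prop. (5.3)]
[cite: Liu2021, App. D §D.1 Step 3 (l. 5221)] -/
theorem exists_detLine_carrier_iff_not_forall_exists_pow_eq (w : PlacesOver E v) :
    (∃ (Ψ : (LemD1OfPlace.standingData E v c N J hcδ hδ hN hJh hJdet).U →* ℂˣ)
        (θ : (LemD1OfPlace.standingData E v c N J hcδ hδ hN hJh hJdet).normOne →* ℂˣ),
        (∀ (g : (LemD1OfPlace.standingData E v c N J hcδ hδ hN hJh hJdet).U)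
          (hg : Matrix.GeneralLinearGroup.det (g : GL (Fin N) (LocalRing E v)) ∈
            (LemD1OfPlace.standingData E v c N J hcδ hδ hN hJh hJdet).normOne),
          Ψ g = θ ⟨Matrix.GeneralLinearGroup.det (g : GL (Fin N) (LocalRing E v)), hg⟩) ∧
        (∀ z : (LemD1OfPlace.standingData E v c N J hcδ hδ hN hJh hJdet).normOne,
          Ψ ((LemD1OfPlace.standingData E v c N J hcδ hδ hN hJh hJdet).scalar z) = 1) ∧
        Ψ ≠ 1) ↔
      ¬ ∀ z : (LemD1OfPlace.standingData E v c N J hcδ hδ hN hJh hJdet).normOne,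
          ∃ y : (LemD1OfPlace.standingData E v c N J hcδ hδ hN hJh hJdet).normOne, y ^ N = z := by
  rw [exists_detLine_carrier_iff E v c hcδ hδ N J hN hJh hJdet w, forall_exists_pow_eq_iff E v c hcδ hδ N J hN hJh hJdet w]

include hcδ in
/-- **INTRINSIC FORM, «⟹»**: where `E_v¹ = (E_v¹)^N`, every character `Ψ` of `U(V)(F_v)` that kills the DETERMINANT-ONE subgroup
`SU(V)(F_v) = {g : det g = 1}` and the centre is trivial — no `θ` needed: `det g = y^N = det(y · 1_N)` with `y ∈ E_v¹`, so
`g · (y · 1_N)⁻¹ ∈ SU(V)(F_v)` and `Ψ(g) = Ψ(y · 1_N) = 1`. [cite: Liu2021, App. D §D.1 Step 3 (l. 5221)] [cite: NeukirchANT1999, Ch. II §5 Prop. (5.3)] -/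
theorem eq_one_of_forall_det_eq_one_of_forall_exists_pow_eq
    (hdiv : ∀ z : (LemD1OfPlace.standingData E v c N J hcδ hδ hN hJh hJdet).normOne,
      ∃ y : (LemD1OfPlace.standingData E v c N J hcδ hδ hN hJh hJdet).normOne, y ^ N = z)
    (Ψ : (LemD1OfPlace.standingData E v c N J hcδ hδ hN hJh hJdet).U →* ℂˣ)
    (hSU : ∀ g : (LemD1OfPlace.standingData E v c N J hcδ hδ hN hJh hJdet).U,
      Matrix.GeneralLinearGroup.det (g : GL (Fin N) (LocalRing E v)) = 1 → Ψ g = 1)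
    (hcen : ∀ z : (LemD1OfPlace.standingData E v c N J hcδ hδ hN hJh hJdet).normOne,
      Ψ ((LemD1OfPlace.standingData E v c N J hcδ hδ hN hJh hJdet).scalar z) = 1) :
    Ψ = 1 := by
  let S := LemD1OfPlace.standingData E v c N J hcδ hδ hN hJh hJdet
  ext g
  obtain ⟨y, hy⟩ := hdiv ⟨Matrix.GeneralLinearGroup.det (g : GL (Fin N) (LocalRing E v)), det_mem_normOne E v c hcδ hδ N J hN hJh hJdet g⟩
  have hy' : ((y : S.normOne) : (LocalRing E v)ˣ) ^ N = Matrix.GeneralLinearGroup.det (g : GL (Fin N) (LocalRing E v)) := by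
    have h := congrArg (fun t : S.normOne => (t : (LocalRing E v)ˣ)) hy
    simpa only [SubgroupClass.coe_pow] using h
  have h1 : Matrix.GeneralLinearGroup.det (((g * (S.scalar y)⁻¹ : S.U)) : GL (Fin N) (LocalRing E v)) = 1 := by
    rw [Subgroup.coe_mul, Subgroup.coe_inv, map_mul, map_inv, det_scalar_val E v c hcδ hδ N J hN hJh hJdet, hy', mul_inv_cancel]
  have h2 := hSU _ h1
  rw [map_mul, map_inv, hcen, inv_one, mul_one] at h2
  rw [h2, MonoidHom.one_apply]

include hcδ in
/-- **INTRINSIC DECISION**: a character of `U(V)(F_v)` killing `SU(V)(F_v) = {det = 1}` and the centre, and non-trivial, EXISTS ⟺ the same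
negated conjunction (the det-line carriers kill `{det = 1}` by their factorisation; conversely §2).  What this leaves for «no carrier
CHARACTER at all» at the places of the conjunction is exactly «every character of `U(V)(F_v)` kills `SU(V)(F_v)`» (perfectness of the
isotropic `SU(V)(F_v)`, not in the tree). [cite: Liu2021, App. D §D.1 Step 3 (l. 5221) and Lemma D.1 (3) (l. 5233)]
[cite: NeukirchANT1999, Ch. II §4 Lemma (4.6) and §5 Prop. (5.3)] -/
theorem exists_character_trivial_on_detOne_iff (w : PlacesOver E v) :
    (∃ Ψ : (LemD1OfPlace.standingData E v c N J hcδ hδ hN hJh hJdet).U →* ℂˣ,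
        (∀ g : (LemD1OfPlace.standingData E v c N J hcδ hδ hN hJh hJdet).U,
          Matrix.GeneralLinearGroup.det (g : GL (Fin N) (LocalRing E v)) = 1 → Ψ g = 1) ∧
        (∀ z : (LemD1OfPlace.standingData E v c N J hcδ hδ hN hJh hJdet).normOne,
          Ψ ((LemD1OfPlace.standingData E v c N J hcδ hδ hN hJh hJdet).scalar z) = 1) ∧
        Ψ ≠ 1) ↔
      ¬ (c • w.1 = w.1 ∧ Odd N ∧ Valued.v ((N : w.1.adicCompletion E)) = 1 ∧
        (v.asIdeal.ramificationIdx' w.1.asIdeal ≠ 1 ∨ Nat.Coprime N (Nat.card (𝓞 F ⧸ v.asIdeal) + 1))) := by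
  constructor
  · rintro ⟨Ψ, hSU, hcen, hne⟩ h
    exact hne (eq_one_of_forall_det_eq_one_of_forall_exists_pow_eq E v c hcδ hδ N J hN hJh hJdet
      ((forall_exists_pow_eq_iff E v c hcδ hδ N J hN hJh hJdet w).2 h) Ψ hSU hcen)
  · intro h
    obtain ⟨Ψ, θ, hfac, hcen, -, ⟨g₀, hg₀⟩, -, -⟩ := exists_detLine_carrier_of_not E v c hcδ hδ N J hN hJh hJdet w h
    refine ⟨Ψ, fun g hg => ?_, hcen, fun h1 => hg₀ (by rw [h1, MonoidHom.one_apply])⟩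
    rw [hfac g (det_mem_normOne E v c hcδ hδ N J hN hJh hJdet g)]
    have h1 : (⟨Matrix.GeneralLinearGroup.det (g : GL (Fin N) (LocalRing E v)), det_mem_normOne E v c hcδ hδ N J hN hJh hJdet g⟩ :
        (LemD1OfPlace.standingData E v c N J hcδ hδ hN hJh hJdet).normOne) = 1 := Subtype.ext hg
    rw [h1, map_one]

/-! ## §3 `N` EVEN `≥ 4`, EVERY non-split place: the joint certificates «(1) ∧ (3)» with ONE conjunct separating -/

omit [NumberField F] [Algebra.IsQuadraticExtension F E] in
/-- `ζ = −1`: `(−1) · c(−1) = 1`, `v_w(−1 − 1) ≠ 0` and, for `N` even, `v_w((−1)^N − 1) = 0 < v_w(−1 − 1)`. [folklore] -/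
private theorem neg_one_witness (w : PlacesOver E v) (hNe : Even N) :
    (-1 : E) * c (-1) = 1 ∧ w.1.valuation E (-1 - 1) ≠ 0 ∧ w.1.valuation E ((-1) ^ N - 1) < w.1.valuation E (-1 - 1) := by
  have h2 : w.1.valuation E (-1 - 1) ≠ 0 := (Valuation.ne_zero_iff _).2 (by norm_num)
  exact ⟨by rw [map_neg, map_one]; ring, h2, by rw [hNe.neg_one_pow, sub_self, map_zero]; exact zero_lt_iff.2 h2⟩

include hcδ in
/-- **(1) ∧ (3) JOINTLY with the `μ`-CONJUNCT ALONE SEPARATING — `N` EVEN `≥ 4`, EVERY non-split place** (ANY `E/F`; dyadic ∕ ramified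
included): ✔ `…InertCarrier.exists_lemD1IndexedFamily_item1_and_lemD1_3_mu_of_norm_one` at `ζ = −1`.  Labels `(μ, e, 1)`, `(μ', e, 1)`,
carriers the trivial line and the line of the even carrier. [cite: Liu2021, App. D Lemma D.1 (1) and (3) (l. 5229, 5233)] -/
theorem exists_lemD1IndexedFamily_item1_and_lemD1_3_mu_of_even (w : PlacesOver E v) (hw : c • w.1 = w.1) (hNe : Even N) (h3 : 3 ≤ N)
    (μ : LemD1.MuSet (LemD1OfPlace.standingData E v c N J hcδ hδ hN hJh hJdet))
    (e : LemD1.EpsRep (LemD1OfPlace.standingData E v c N J hcδ hδ hN hJh hJdet)) :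
    ∃ Lf : LemD1IndexedFamily (v.adicCompletion F) (LocalRing E v) N (Fin 2),
      Lf.S = LemD1OfPlace.standingData E v c N J hcδ hδ hN hJh hJdet ∧
      (∀ i, (Lf.eps i).1 = e.1) ∧ (∀ i, (Lf.chi i).1 = 1) ∧ (Lf.mu 0).1 = μ.1 ∧
      (Lf.mu 1).1 (LemD1OfPlace.eps E v hδ) = -μ.1 (LemD1OfPlace.eps E v hδ) ∧
      Lf.Item1AsPrinted ∧ LemD1_3AsPrintedI Lf ∧
      Lf.mu 0 ≠ Lf.mu 1 ∧ LemD1.SameClass (Lf.eps 0) (Lf.eps 1) ∧ Lf.chi 0 = Lf.chi 1 ∧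
      ¬ AreIsomorphicRep (Lf.quot 1) (Lf.quot 0) := by
  obtain ⟨hc1, h0, hlt⟩ := neg_one_witness E v c N w hNe
  exact LemD1IndexedNonVacuityInertCarrier.exists_lemD1IndexedFamily_item1_and_lemD1_3_mu_of_norm_one E v c hcδ hδ N J hN hJh hJdet
    w hw (-1) hc1 h0 hlt h3 μ e

include hcδ in
/-- **(1) ∧ (3) JOINTLY with the `ε`-CONJUNCT ALONE SEPARATING — `N` EVEN `≥ 4`, EVERY non-split place**:
✔ `…InertEpsAlone.exists_lemD1IndexedFamily_item1_and_lemD1_3_eps_of_norm_one` at `ζ = −1`. [cite: Liu2021, App. D Lemma D.1 (1) and (3) (l. 5229, 5233)] -/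
theorem exists_lemD1IndexedFamily_item1_and_lemD1_3_eps_of_even (w : PlacesOver E v) (hw : c • w.1 = w.1) (hNe : Even N) (h3 : 3 ≤ N)
    (μ : LemD1.MuSet (LemD1OfPlace.standingData E v c N J hcδ hδ hN hJh hJdet))
    (e : LemD1.EpsRep (LemD1OfPlace.standingData E v c N J hcδ hδ hN hJh hJdet)) :
    ∃ Lf : LemD1IndexedFamily (v.adicCompletion F) (LocalRing E v) N (Fin 2),
      Lf.S = LemD1OfPlace.standingData E v c N J hcδ hδ hN hJh hJdet ∧
      (Lf.eps 0).1 = e.1 ∧ (∀ i, (Lf.mu i).1 = μ.1) ∧ (∀ i, (Lf.chi i).1 = 1) ∧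
      Lf.Item1AsPrinted ∧ LemD1_3AsPrintedI Lf ∧
      Lf.mu 0 = Lf.mu 1 ∧ ¬ LemD1.SameClass (Lf.eps 0) (Lf.eps 1) ∧ Lf.chi 0 = Lf.chi 1 ∧
      ¬ AreIsomorphicRep (Lf.quot 1) (Lf.quot 0) := by
  obtain ⟨hc1, h0, hlt⟩ := neg_one_witness E v c N w hNe
  exact LemD1IndexedNonVacuityInertEpsAlone.exists_lemD1IndexedFamily_item1_and_lemD1_3_eps_of_norm_one E v c hcδ hδ N J hN hJh hJdet
    w hw (-1) hc1 h0 hlt h3 μ e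

include hcδ in
/-- **Consequence — `N` EVEN `≥ 4`, EVERY non-split place, NO hypothesis on `μ`** (`MuSet S` is non-empty at every place,
✔ `…NormClassExtensionDyadic.nonempty_muSet`): the records (1) ∧ (3) do NOT by their shape force «same `ε`-class ∧ same `χ` ⟹ same `μ`».
[cite: Liu2021, App. D Lemma D.1 (1) and (3) (l. 5229, 5233)] -/
theorem not_forall_mu_eq_of_sameClass_of_chi_eq_of_even (w : PlacesOver E v) (hw : c • w.1 = w.1) (hNe : Even N) (h3 : 3 ≤ N) :
    ¬ ∀ Lf : LemD1IndexedFamily (v.adicCompletion F) (LocalRing E v) N (Fin 2),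
        Lf.S = LemD1OfPlace.standingData E v c N J hcδ hδ hN hJh hJdet →
        Lf.Item1AsPrinted → LemD1_3AsPrintedI Lf →
        ∀ i j : Fin 2, LemD1.SameClass (Lf.eps i) (Lf.eps j) → Lf.chi i = Lf.chi j → Lf.mu i = Lf.mu j := by
  obtain ⟨μ⟩ := LemD1IndexedNonVacuityNormClassExtensionDyadic.nonempty_muSet E v c hcδ hδ N J hN hJh hJdet
  intro h
  obtain ⟨Lf, hS, -, -, -, -, h1, h3', hne, hsame, hchi, -⟩ :=
    exists_lemD1IndexedFamily_item1_and_lemD1_3_mu_of_even E v c hcδ hδ N J hN hJh hJdet w hw hNe h3 μ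
      (LemD1OfPlace.epsDelta E v c N J hcδ hδ hN hJh hJdet)
  exact hne (h Lf hS h1 h3' 0 1 hsame hchi)

include hcδ in
/-- **… nor «same Step-3 character `χ` ⟹ isomorphic `ω`'s»** — `N` even `≥ 4`, every non-split place.
[cite: Liu2021, App. D Lemma D.1 (1) and (3) (l. 5229, 5233)] -/
theorem not_forall_areIsomorphicRep_of_chi_eq_of_even (w : PlacesOver E v) (hw : c • w.1 = w.1) (hNe : Even N) (h3 : 3 ≤ N) :
    ¬ ∀ Lf : LemD1IndexedFamily (v.adicCompletion F) (LocalRing E v) N (Fin 2),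
        Lf.S = LemD1OfPlace.standingData E v c N J hcδ hδ hN hJh hJdet →
        Lf.Item1AsPrinted → LemD1_3AsPrintedI Lf →
        ∀ i j : Fin 2, Lf.chi i = Lf.chi j → AreIsomorphicRep (Lf.quot j) (Lf.quot i) := by
  obtain ⟨μ⟩ := LemD1IndexedNonVacuityNormClassExtensionDyadic.nonempty_muSet E v c hcδ hδ N J hN hJh hJdet
  intro h
  obtain ⟨Lf, hS, -, -, -, -, h1, h3', -, -, hchi, hnot⟩ :=
    exists_lemD1IndexedFamily_item1_and_lemD1_3_mu_of_even E v c hcδ hδ N J hN hJh hJdet w hw hNe h3 μ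
      (LemD1OfPlace.epsDelta E v c N J hcδ hδ hN hJh hJdet)
  exact hnot (h Lf hS h1 h3' 0 1 hchi)

include hcδ in
/-- **… nor «same `μ` ∧ same `χ` ⟹ same `ε`-class»** — `N` even `≥ 4`, every non-split place
(✔ `…InertEpsAlone.not_forall_sameClass_of_mu_eq_of_chi_eq_of_norm_one` at `ζ = −1`). [cite: Liu2021, App. D Lemma D.1 (1) and (3) (l. 5229, 5233)] -/
theorem not_forall_sameClass_of_mu_eq_of_chi_eq_of_even (w : PlacesOver E v) (hw : c • w.1 = w.1) (hNe : Even N) (h3 : 3 ≤ N) :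
    ¬ ∀ Lf : LemD1IndexedFamily (v.adicCompletion F) (LocalRing E v) N (Fin 2),
        Lf.S = LemD1OfPlace.standingData E v c N J hcδ hδ hN hJh hJdet →
        Lf.Item1AsPrinted → LemD1_3AsPrintedI Lf →
        ∀ i j : Fin 2, Lf.mu i = Lf.mu j → Lf.chi i = Lf.chi j → LemD1.SameClass (Lf.eps i) (Lf.eps j) := by
  obtain ⟨hc1, h0, hlt⟩ := neg_one_witness E v c N w hNe
  exact LemD1IndexedNonVacuityInertEpsAlone.not_forall_sameClass_of_mu_eq_of_chi_eq_of_norm_one E v c hcδ hδ N J hN hJh hJdet w hw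
    (-1) hc1 h0 hlt h3

end PlaceModel

/-! ## §4 The CM rows: `L` CM, `F = L⁺`, `c` = complex conjugation; THE END's `N = 3` -/

section CM

open Literature.NumberTheory.GelbartRogawski1991.UnitaryDualPair (imagUnit complexConj_imagUnit imagUnit_ne_zero)
open Literature.NumberTheory.GelbartRogawski1991.UnitaryDualPair.LocalSplitting (localMu norm_localMu continuous_localMu
  localMu_toLocalRing_eq_one_iff)
open Literature.NumberTheory.Automorphic.IdeleClassGroup (toHeckeCharacter isUnitary_toHeckeCharacter IsConjugateSymplectic)
open Literature.RepresentationTheory.Liu2021 (isOscillatorChar_toHeckeCharacter_iff)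

variable (L : Type) [Field L] [NumberField L] [IsCMField L]

local notation3 "cc" => (IsCMField.complexConj L)
local notation3 "L⁺" => (↥(maximalRealSubfield L))

variable (v : HeightOneSpectrum (𝓞 (maximalRealSubfield L))) (N : ℕ) (J : Matrix (Fin N) (Fin N) L) (hN : 2 ≤ N)
  (hJh : (J.map (IsCMField.complexConj L))ᵀ = J) (hJdet : J.det ≠ 0)

/-- **CM rows: THE DET-LINE DECISION** at every finite place `w ∣ v` of `L`, every rank `N ≥ 2`: a det-line character of `U(V)(L⁺_v)` trivial
on the centre and non-trivial exists ⟺ ¬ (`\bar w = w` ∧ `Odd N` ∧ `v_w(N) = 1` ∧ (`e(w|v) ≠ 1` ∨ `gcd(N, q_v + 1) = 1`)).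
[cite: Liu2021, App. D §D.1 Step 3 (l. 5221) and Lemma D.1 (3) (l. 5233)] [cite: NeukirchANT1999, Ch. II §4 Lemma (4.6) and §5 Prop. (5.3)] -/
theorem exists_detLine_carrier_iff_of_isCMField (w : PlacesOver L v) :
    (∃ (Ψ : (LemD1OfPlace.standingData L v cc N J (complexConj_imagUnit L) (imagUnit_ne_zero L) hN hJh hJdet).U →* ℂˣ)
        (θ : (LemD1OfPlace.standingData L v cc N J (complexConj_imagUnit L) (imagUnit_ne_zero L) hN hJh hJdet).normOne →* ℂˣ),
        (∀ (g : (LemD1OfPlace.standingData L v cc N J (complexConj_imagUnit L) (imagUnit_ne_zero L) hN hJh hJdet).U)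
          (hg : Matrix.GeneralLinearGroup.det (g : GL (Fin N) (LocalRing L v)) ∈
            (LemD1OfPlace.standingData L v cc N J (complexConj_imagUnit L) (imagUnit_ne_zero L) hN hJh hJdet).normOne),
          Ψ g = θ ⟨Matrix.GeneralLinearGroup.det (g : GL (Fin N) (LocalRing L v)), hg⟩) ∧
        (∀ z : (LemD1OfPlace.standingData L v cc N J (complexConj_imagUnit L) (imagUnit_ne_zero L) hN hJh hJdet).normOne,
          Ψ ((LemD1OfPlace.standingData L v cc N J (complexConj_imagUnit L) (imagUnit_ne_zero L) hN hJh hJdet).scalar z) = 1) ∧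
        Ψ ≠ 1) ↔
      ¬ (cc • w.1 = w.1 ∧ Odd N ∧ Valued.v ((N : w.1.adicCompletion L)) = 1 ∧
        (v.asIdeal.ramificationIdx' w.1.asIdeal ≠ 1 ∨ Nat.Coprime N (Nat.card (𝓞 L⁺ ⧸ v.asIdeal) + 1))) :=
  exists_detLine_carrier_iff L v cc (complexConj_imagUnit L) (imagUnit_ne_zero L) N J hN hJh hJdet w

/-- **CM rows: `E_v¹` of the rows' standing data is `N`-divisible ⟺ the same conjunction.** [cite: NeukirchANT1999, Ch. II §4 Lemma (4.6) and §5 Prop. (5.3)]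
[cite: Liu2021, App. D §D.1 Step 3 (l. 5221)] -/
theorem forall_exists_pow_eq_iff_of_isCMField (w : PlacesOver L v) :
    (∀ z : (LemD1OfPlace.standingData L v cc N J (complexConj_imagUnit L) (imagUnit_ne_zero L) hN hJh hJdet).normOne,
        ∃ y : (LemD1OfPlace.standingData L v cc N J (complexConj_imagUnit L) (imagUnit_ne_zero L) hN hJh hJdet).normOne, y ^ N = z) ↔
      (cc • w.1 = w.1 ∧ Odd N ∧ Valued.v ((N : w.1.adicCompletion L)) = 1 ∧
        (v.asIdeal.ramificationIdx' w.1.asIdeal ≠ 1 ∨ Nat.Coprime N (Nat.card (𝓞 L⁺ ⧸ v.asIdeal) + 1))) :=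
  forall_exists_pow_eq_iff L v cc (complexConj_imagUnit L) (imagUnit_ne_zero L) N J hN hJh hJdet w

/-- **CM rows: the intrinsic decision** — a character of `U(V)(L⁺_v)` killing `{det = 1}` and the centre, non-trivial, exists ⟺ the same
negated conjunction. [cite: Liu2021, App. D §D.1 Step 3 (l. 5221) and Lemma D.1 (3) (l. 5233)] [cite: NeukirchANT1999, Ch. II §5 Prop. (5.3)] -/
theorem exists_character_trivial_on_detOne_iff_of_isCMField (w : PlacesOver L v) :
    (∃ Ψ : (LemD1OfPlace.standingData L v cc N J (complexConj_imagUnit L) (imagUnit_ne_zero L) hN hJh hJdet).U →* ℂˣ,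
        (∀ g : (LemD1OfPlace.standingData L v cc N J (complexConj_imagUnit L) (imagUnit_ne_zero L) hN hJh hJdet).U,
          Matrix.GeneralLinearGroup.det (g : GL (Fin N) (LocalRing L v)) = 1 → Ψ g = 1) ∧
        (∀ z : (LemD1OfPlace.standingData L v cc N J (complexConj_imagUnit L) (imagUnit_ne_zero L) hN hJh hJdet).normOne,
          Ψ ((LemD1OfPlace.standingData L v cc N J (complexConj_imagUnit L) (imagUnit_ne_zero L) hN hJh hJdet).scalar z) = 1) ∧
        Ψ ≠ 1) ↔
      ¬ (cc • w.1 = w.1 ∧ Odd N ∧ Valued.v ((N : w.1.adicCompletion L)) = 1 ∧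
        (v.asIdeal.ramificationIdx' w.1.asIdeal ≠ 1 ∨ Nat.Coprime N (Nat.card (𝓞 L⁺ ⧸ v.asIdeal) + 1))) :=
  exists_character_trivial_on_detOne_iff L v cc (complexConj_imagUnit L) (imagUnit_ne_zero L) N J hN hJh hJdet w

/-- **CM rows, `N` EVEN `≥ 4`: the `μ`-alone certificate with the rows' OWN `μ_v` as member `0` at EVERY non-split place `w ∣ v` of `L`**
(ANY CM field, every conjugate symplectic `ψ`; `v` dyadic or ramified in `L` allowed). [cite: Liu2021, App. D Lemma D.1 (1) and (3) (l. 5229, 5233); Def. 4.11 (l. 2086)] -/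
theorem exists_lemD1IndexedFamily_item1_and_lemD1_3_localMu_mu_of_even (w : PlacesOver L v) (hw : cc • w.1 = w.1) (hNe : Even N)
    (h3 : 3 ≤ N) (ψ : IdeleClassGroup L →ₜ* Circle) (hψ : IsConjugateSymplectic L ψ) :
    ∃ Lf : LemD1IndexedFamily (v.adicCompletion L⁺) (LocalRing L v) N (Fin 2),
      Lf.S = LemD1OfPlace.standingData L v cc N J (complexConj_imagUnit L) (imagUnit_ne_zero L) hN hJh hJdet ∧
      (∀ i, (Lf.eps i).1 = LemD1OfPlace.eps L v (imagUnit_ne_zero L)) ∧ (∀ i, (Lf.chi i).1 = 1) ∧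
      (Lf.mu 0).1 = localMu L (toHeckeCharacter L ψ) v ∧
      (Lf.mu 1).1 (LemD1OfPlace.eps L v (imagUnit_ne_zero L)) =
        -localMu L (toHeckeCharacter L ψ) v (LemD1OfPlace.eps L v (imagUnit_ne_zero L)) ∧
      Lf.Item1AsPrinted ∧ LemD1_3AsPrintedI Lf ∧
      Lf.mu 0 ≠ Lf.mu 1 ∧ LemD1.SameClass (Lf.eps 0) (Lf.eps 1) ∧ Lf.chi 0 = Lf.chi 1 ∧
      ¬ AreIsomorphicRep (Lf.quot 1) (Lf.quot 0) :=
  exists_lemD1IndexedFamily_item1_and_lemD1_3_mu_of_even L v cc (complexConj_imagUnit L) (imagUnit_ne_zero L) N J hN hJh hJdet w hw hNe h3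
    (LemD1OfPlace.muOf L v cc N J (complexConj_imagUnit L) (imagUnit_ne_zero L) hN hJh hJdet
      (localMu L (toHeckeCharacter L ψ) v)
      (fun x => norm_localMu L (toHeckeCharacter L ψ) v (isUnitary_toHeckeCharacter L ψ) x)
      (continuous_localMu L (toHeckeCharacter L ψ) v)
      (fun t => localMu_toLocalRing_eq_one_iff L (toHeckeCharacter L ψ) v
        ((isOscillatorChar_toHeckeCharacter_iff ψ).mpr hψ) t))
    (LemD1OfPlace.epsDelta L v cc N J (complexConj_imagUnit L) (imagUnit_ne_zero L) hN hJh hJdet)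

/-- **CM rows, `N` even `≥ 4`: the records `hD1''` ∕ `hD3` read at the rows' slot types do not force «same `ε`-class ∧ same `χ` ⟹ same `μ`»
at any non-split place of `L`.** [cite: Liu2021, App. D Lemma D.1 (1) and (3) (l. 5229, 5233)] -/
theorem not_forall_mu_eq_of_sameClass_of_chi_eq_of_isCMField_of_even (w : PlacesOver L v) (hw : cc • w.1 = w.1) (hNe : Even N)
    (h3 : 3 ≤ N) :
    ¬ ∀ Lf : LemD1IndexedFamily (v.adicCompletion L⁺) (LocalRing L v) N (Fin 2),
        Lf.S = LemD1OfPlace.standingData L v cc N J (complexConj_imagUnit L) (imagUnit_ne_zero L) hN hJh hJdet →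
        Lf.Item1AsPrinted → LemD1_3AsPrintedI Lf →
        ∀ i j : Fin 2, LemD1.SameClass (Lf.eps i) (Lf.eps j) → Lf.chi i = Lf.chi j → Lf.mu i = Lf.mu j :=
  not_forall_mu_eq_of_sameClass_of_chi_eq_of_even L v cc (complexConj_imagUnit L) (imagUnit_ne_zero L) N J hN hJh hJdet w hw hNe h3

/-- **… nor «same `χ` ⟹ isomorphic carriers», nor «same `μ` ∧ same `χ` ⟹ same `ε`-class»** (same hypotheses).
[cite: Liu2021, App. D Lemma D.1 (1) and (3) (l. 5229, 5233)] -/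
theorem not_forall_areIsomorphicRep_of_chi_eq_of_isCMField_of_even (w : PlacesOver L v) (hw : cc • w.1 = w.1) (hNe : Even N)
    (h3 : 3 ≤ N) :
    (¬ ∀ Lf : LemD1IndexedFamily (v.adicCompletion L⁺) (LocalRing L v) N (Fin 2),
        Lf.S = LemD1OfPlace.standingData L v cc N J (complexConj_imagUnit L) (imagUnit_ne_zero L) hN hJh hJdet →
        Lf.Item1AsPrinted → LemD1_3AsPrintedI Lf →
        ∀ i j : Fin 2, Lf.chi i = Lf.chi j → AreIsomorphicRep (Lf.quot j) (Lf.quot i)) ∧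
    (¬ ∀ Lf : LemD1IndexedFamily (v.adicCompletion L⁺) (LocalRing L v) N (Fin 2),
        Lf.S = LemD1OfPlace.standingData L v cc N J (complexConj_imagUnit L) (imagUnit_ne_zero L) hN hJh hJdet →
        Lf.Item1AsPrinted → LemD1_3AsPrintedI Lf →
        ∀ i j : Fin 2, Lf.mu i = Lf.mu j → Lf.chi i = Lf.chi j → LemD1.SameClass (Lf.eps i) (Lf.eps j)) :=
  ⟨not_forall_areIsomorphicRep_of_chi_eq_of_even L v cc (complexConj_imagUnit L) (imagUnit_ne_zero L) N J hN hJh hJdet w hw hNe h3,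
    not_forall_sameClass_of_mu_eq_of_chi_eq_of_even L v cc (complexConj_imagUnit L) (imagUnit_ne_zero L) N J hN hJh hJdet w hw hNe h3⟩

/-- `Nat.Coprime 3 (q + 1) ↔ ¬ 3 ∣ q + 1` (`3` prime). [folklore] -/
private theorem coprime_three_iff {q : ℕ} : Nat.Coprime 3 (q + 1) ↔ ¬ 3 ∣ q + 1 :=
  Nat.Prime.coprime_iff_not_dvd Nat.prime_three

/-- **THE END's `N = 3` AS ONE IFF** (ANY CM field `L`, ANY hermitian `J₃`, EVERY finite place `w ∣ v` of `L`): a det-line character of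
`U(V)(L⁺_v)` trivial on the centre and non-trivial exists in the rows' place model of rank `3` ⟺ NOT (`\bar w = w` ∧ `v_w(3) = 1` ∧
(`e(w|v) ≠ 1` ∨ `3 ∤ q_v + 1`)) — i.e. iff `w` is split, or `w ∣ 3`, or `w` is inert with `q_v ≡ 2 (mod 3)`; the lineage's ✔ DetCarrier ∕
✔ WildCarrier ∕ ✔ InertCarrier ∕ ✔ InertConverse ∕ ✔ RamifiedConverse picture in one statement. [cite: Liu2021, App. D Lemma D.1 (3) (l. 5233)]
[cite: NeukirchANT1999, Ch. II §4 Lemma (4.6) and §5 Prop. (5.3)] -/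
theorem exists_detLine_carrier_iff_of_isCMField_three (J₃ : Matrix (Fin 3) (Fin 3) L) (hJh₃ : (J₃.map (IsCMField.complexConj L))ᵀ = J₃)
    (hJdet₃ : J₃.det ≠ 0) (w : PlacesOver L v) :
    (∃ (Ψ : (LemD1OfPlace.standingData L v cc 3 J₃ (complexConj_imagUnit L) (imagUnit_ne_zero L) (by norm_num) hJh₃ hJdet₃).U →* ℂˣ)
        (θ : (LemD1OfPlace.standingData L v cc 3 J₃ (complexConj_imagUnit L) (imagUnit_ne_zero L) (by norm_num) hJh₃ hJdet₃).normOne →* ℂˣ),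
        (∀ (g : (LemD1OfPlace.standingData L v cc 3 J₃ (complexConj_imagUnit L) (imagUnit_ne_zero L) (by norm_num) hJh₃ hJdet₃).U)
          (hg : Matrix.GeneralLinearGroup.det (g : GL (Fin 3) (LocalRing L v)) ∈
            (LemD1OfPlace.standingData L v cc 3 J₃ (complexConj_imagUnit L) (imagUnit_ne_zero L) (by norm_num) hJh₃ hJdet₃).normOne),
          Ψ g = θ ⟨Matrix.GeneralLinearGroup.det (g : GL (Fin 3) (LocalRing L v)), hg⟩) ∧
        (∀ z : (LemD1OfPlace.standingData L v cc 3 J₃ (complexConj_imagUnit L) (imagUnit_ne_zero L) (by norm_num) hJh₃ hJdet₃).normOne,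
          Ψ ((LemD1OfPlace.standingData L v cc 3 J₃ (complexConj_imagUnit L) (imagUnit_ne_zero L) (by norm_num) hJh₃ hJdet₃).scalar z) = 1) ∧
        Ψ ≠ 1) ↔
      ¬ (cc • w.1 = w.1 ∧ Valued.v ((3 : ℕ) : w.1.adicCompletion L) = 1 ∧
        (v.asIdeal.ramificationIdx' w.1.asIdeal ≠ 1 ∨ ¬ 3 ∣ Nat.card (𝓞 L⁺ ⧸ v.asIdeal) + 1)) := by
  rw [exists_detLine_carrier_iff_of_isCMField L v 3 J₃ (by norm_num) hJh₃ hJdet₃ w, ← coprime_three_iff]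
  have h3 : Odd 3 := by decide
  simp only [h3, true_and]

end CM

end Literature.NumberTheory.Automorphic.Liu2021.LemD1IndexedNonVacuityDetLineDecision

end
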